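import Summits.QuantumFields.YangMills.Theorems.IR.BlockedActivityWLocChainLaw
import HarnessLib

/-!
# Crux `IR` (stmt-QuantumFields-19354), lane B «strong coupling AFTER BLOCKING»: chain representations, part 2 — the factors, double centring,
# the full chain

Helper module for item `stmt-QuantumFields-19354` (`--supports`; it closes nothing), lane `ym-19354-onsetsc-p2` (g4); part 2 of the chain
construction for Q-loc (part 1: `BlockedActivityWLocChainLaw`).  The factor of position `k` (cell `c_{k+1}`) is `Z · 1[labels of bonds k, k+1
agree] · sgn_k sgn_{k+1}` inside and `2Z t_i η_i sgn` at the reading end (`fac`; `|fac| ≤ Z` for `|η| ≤ 1`, `abs_fac_le`).  Under the flip of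
bond `j` a factor changes sign iff it reads `j` (`fac_flipAt`, `prod_fac_flipAt`); the three counting lemmas (`filter_reads_min'`,
`filter_reads_zero`, `filter_reads_gap` with `exists_gap`) exhibit, for every proper sub-product, a bond read exactly once, whence
**every nonempty product of factors integrates to zero** (`integral_prod_fac_eq_zero`) and **every proper product decorated by the centre sign
integrates to zero** (`integral_sgn_prod_fac_eq_zero`); the full chain is supported on «all labels show one mode» with the signs squaring to `1`
(`sgn_mul_prod_fac`, `integral_full_chain`).  Consequences: **the normaliser is exactly `1`** (`den_eq_one`) and **the numerator is the mode sum**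
`A + Σ_i t_i^{m+2} η_i D_i` (`num_eq`).  Parts 3–4 assemble the `BlockedRepOnLoc`.

HONEST FRAMING: finite combinatorics and bookkeeping on the label space; nothing about Yang–Mills, weak coupling, a gap or Clay.
No `sorry`; axioms ⊆ {propext, Classical.choice, Quot.sound}; no instances, no notation.
Refs: KoteckyPreiss1986; FriedliVelenik2017 §5.7.1.
-/


set_option autoImplicit false

noncomputable section

open MeasureTheory ProbabilityTheory Finset
open scoped ENNReal
open Literature.MathematicalPhysics.QuantumFieldTheory Literature.MathematicalPhysics.QuantumLattice
open Literature.Probability.LatticeModels (IsLocalPerturbation IsLocalObservable pertExpect pertNum pertZ Touches)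
open Summit.QuantumFields.YangMills.Cruxes.IR.Tempered (cellEdges windowCells regionEdges)

namespace Summit.QuantumFields.YangMills.Cruxes.IR.BlockedActivity

namespace Chain

namespace Weights

variable (W : Weights)

/-! ## §3 The chain factors -/

variable {m : ℕ}

/-- The factor of position `k` (cell `c_{k+1}`) with end couplings `η` (at the reading cell, `η_i = ψ_i(σ)`):
`Z · 1[labels of bonds k, k+1 agree] · sgn_k sgn_{k+1}` inside, `2Z t_i η_i sgn` at the end. -/
def fac (η : ℕ → ℝ) (k : Fin (m + 1)) (b : BondCfg m) : ℝ :=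
  if h : k.val + 1 < m + 1 then
    W.Z * (if (b k).1 = (b ⟨k.val + 1, h⟩).1 then 1 else 0) * sgn (b k) * sgn (b ⟨k.val + 1, h⟩)
  else 2 * W.Z * W.t (b k).1 * η (b k).1 * sgn (b k)

/-- The factors are bounded by `Z` (for `|η| ≤ 1`, using `t_i ≤ Z ≤ 1∕2`). -/
theorem abs_fac_le {η : ℕ → ℝ} (hη : ∀ i, |η i| ≤ 1) (k : Fin (m + 1)) (b : BondCfg m) : |W.fac η k b| ≤ W.Z := by
  unfold fac
  by_cases h : k.val + 1 < m + 1
  · rw [dif_pos h, abs_mul, abs_mul, abs_mul, abs_sgn, abs_sgn, mul_one, mul_one, abs_of_pos W.Z_pos]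
    have h1 : |(if (b k).1 = (b ⟨k.val + 1, h⟩).1 then (1 : ℝ) else 0)| ≤ 1 := by split_ifs <;> simp
    calc W.Z * |(if (b k).1 = (b ⟨k.val + 1, h⟩).1 then (1 : ℝ) else 0)| ≤ W.Z * 1 :=
          mul_le_mul_of_nonneg_left h1 W.Z_pos.le
      _ = W.Z := mul_one _
  · rw [dif_neg h, abs_mul, abs_sgn, mul_one, abs_mul, abs_mul, abs_mul, abs_of_pos W.Z_pos, abs_two, abs_of_nonneg (W.t_nonneg _)]
    have h1 : W.t (b k).1 * |η (b k).1| ≤ W.Z * 1 := mul_le_mul (W.t_le_Z _) (hη _) (abs_nonneg _) W.Z_pos.le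
    calc 2 * W.Z * W.t (b k).1 * |η (b k).1| = 2 * W.Z * (W.t (b k).1 * |η (b k).1|) := by ring
      _ ≤ 2 * W.Z * (W.Z * 1) := mul_le_mul_of_nonneg_left h1 (by linarith [W.Z_pos])
      _ ≤ W.Z := by nlinarith [W.Z_pos, W.Z_le]

/-- A product of factors is bounded by `1`. -/
theorem abs_prod_fac_le {η : ℕ → ℝ} (hη : ∀ i, |η i| ≤ 1) (B : Finset (Fin (m + 1))) (b : BondCfg m) :
    |∏ k ∈ B, W.fac η k b| ≤ 1 := by
  rw [Finset.abs_prod]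
  exact prod_le_one (fun k _ => abs_nonneg _) fun k _ => (W.abs_fac_le hη k b).trans W.Z_le_one

/-- How one factor transforms under the flip of bond `j`: it changes sign iff it READS `j` — position `k` (the cell `c_{k+1}`) reads the
bonds `k` and `k+1`. -/
theorem fac_flipAt (η : ℕ → ℝ) (k j : Fin (m + 1)) (b : BondCfg m) :
    W.fac η k (flipAt j b) = (if (j = k ∨ j.val = k.val + 1) then -1 else 1) * W.fac η k b := by
  unfold fac
  by_cases h : k.val + 1 < m + 1
  · rw [dif_pos h, dif_pos h, flipAt_fst, flipAt_fst, sgn_flipAt, sgn_flipAt]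
    have hne : (⟨k.val + 1, h⟩ : Fin (m + 1)) ≠ k := fun e => by
      have := congrArg Fin.val e; simp at this
    have key : (if k = j then (-1 : ℝ) else 1) * (if (⟨k.val + 1, h⟩ : Fin (m + 1)) = j then -1 else 1) =
        (if (j = k ∨ j.val = k.val + 1) then -1 else 1) := by
      by_cases h1 : j = k
      · subst h1; simp [hne]
      · have hk : ¬ k = j := fun e => h1 e.symm
        by_cases h2 : j.val = k.val + 1
        · have hj : (⟨k.val + 1, h⟩ : Fin (m + 1)) = j := Fin.ext (by simp [h2])
          simp [hk, hj, h1, h2]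
        · have hj : ¬ (⟨k.val + 1, h⟩ : Fin (m + 1)) = j := fun e => h2 (by rw [← e])
          simp [hk, hj, h1, h2]
    rw [← key]; ring
  · rw [dif_neg h, dif_neg h, flipAt_fst, sgn_flipAt]
    have key : (if k = j then (-1 : ℝ) else 1) = (if (j = k ∨ j.val = k.val + 1) then -1 else 1) := by
      by_cases h1 : j = k
      · subst h1; simp
      · have hk : ¬ k = j := fun e => h1 e.symm
        have h2 : ¬ j.val = k.val + 1 := fun e => h (by rw [← e]; exact j.isLt)
        simp [hk, h1, h2]
    rw [← key]; ring

/-- How a product of factors transforms under the flip of bond `j`. -/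
theorem prod_fac_flipAt (η : ℕ → ℝ) (B : Finset (Fin (m + 1))) (j : Fin (m + 1)) (b : BondCfg m) :
    ∏ k ∈ B, W.fac η k (flipAt j b) = (-1) ^ (B.filter fun k => j = k ∨ j.val = k.val + 1).card * ∏ k ∈ B, W.fac η k b := by
  rw [prod_congr rfl fun k _ => W.fac_flipAt η k j b, prod_mul_distrib, prod_ite, prod_const, prod_const_one, mul_one]

/-! ### The three counting lemmas -/

/-- The lowest position of a nonempty `B` is the only position of `B` reading its own lower bond. -/
theorem filter_reads_min' (B : Finset (Fin (m + 1))) (hB : B.Nonempty) :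
    (B.filter fun k => B.min' hB = k ∨ (B.min' hB).val = k.val + 1) = {B.min' hB} := by
  ext k
  simp only [mem_filter, mem_singleton]
  constructor
  · rintro ⟨hk, h | h⟩
    · exact h.symm
    · exfalso
      have hle : B.min' hB ≤ k := min'_le B k hk
      have : (B.min' hB).val ≤ k.val := hle
      omega
  · intro h; subst h; exact ⟨min'_mem B hB, Or.inl rfl⟩

/-- If position `0` is absent, no position of `B` reads bond `0`. -/
theorem filter_reads_zero (B : Finset (Fin (m + 1))) (h0 : (0 : Fin (m + 1)) ∉ B) :
    (B.filter fun k => (0 : Fin (m + 1)) = k ∨ (0 : Fin (m + 1)).val = k.val + 1) = ∅ := by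
  ext k
  simp only [mem_filter, Fin.val_zero, notMem_empty, iff_false, not_and]
  rintro hk (h | h)
  · exact h0 (h ▸ hk)
  · omega

/-- A proper `B` containing position `0` has a GAP: a position in `B` whose successor is not. -/
theorem exists_gap (B : Finset (Fin (m + 1))) (h0 : (0 : Fin (m + 1)) ∈ B) (hB : B ≠ univ) :
    ∃ k ∈ B, ∃ h : k.val + 1 < m + 1, (⟨k.val + 1, h⟩ : Fin (m + 1)) ∉ B := by
  by_contra hcon
  apply hB
  refine eq_univ_iff_forall.2 fun k => ?_
  suffices hall : ∀ n : ℕ, ∀ hn : n < m + 1, (⟨n, hn⟩ : Fin (m + 1)) ∈ B from by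
    have := hall k.val k.isLt; simpa using this
  intro n
  induction n with
  | zero => intro hn; exact h0
  | succ n ih =>
    intro hn
    by_contra hnot
    exact hcon ⟨⟨n, by omega⟩, ih (by omega), hn, hnot⟩

/-- At a gap `k ∈ B`, `k+1 ∉ B`, the position `k` is the only position of `B` reading bond `k+1`. -/
theorem filter_reads_gap (B : Finset (Fin (m + 1))) {k : Fin (m + 1)} (hk : k ∈ B) (h : k.val + 1 < m + 1)
    (hk1 : (⟨k.val + 1, h⟩ : Fin (m + 1)) ∉ B) :
    (B.filter fun k' => (⟨k.val + 1, h⟩ : Fin (m + 1)) = k' ∨ (⟨k.val + 1, h⟩ : Fin (m + 1)).val = k'.val + 1) = {k} := by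
  ext k'
  simp only [mem_filter, mem_singleton, Fin.ext_iff]
  constructor
  · rintro ⟨hk', h' | h'⟩
    · exfalso; exact hk1 (by
        have : (⟨k.val + 1, h⟩ : Fin (m + 1)) = k' := Fin.ext (by simpa using h')
        rw [this]; exact hk')
    · simp at h'; omega
  · intro e
    have : k' = k := Fin.ext e
    subst this
    exact ⟨hk, Or.inr rfl⟩

/-! ### Vanishing of the proper sub-products, value of the full chain -/

/-- **Every nonempty product of factors integrates to zero** (flip the lowest bond of `B`). -/
theorem integral_prod_fac_eq_zero {η : ℕ → ℝ} (hη : ∀ i, |η i| ≤ 1) (B : Finset (Fin (m + 1))) (hB : B.Nonempty) :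
    ∫ b, ∏ k ∈ B, W.fac η k b ∂(W.chainLaw m) = 0 := by
  refine W.integral_eq_zero_of_odd (B.min' hB) _ 1 (W.abs_prod_fac_le hη B) fun b => ?_
  rw [prod_fac_flipAt, filter_reads_min', card_singleton, pow_one]
  ring

/-- **Every proper product of factors decorated by the centre sign integrates to zero** (flip bond `0` if position `0` is absent, else the first gap). -/
theorem integral_sgn_prod_fac_eq_zero {η : ℕ → ℝ} (hη : ∀ i, |η i| ≤ 1) (D : ℕ → ℝ) {C : ℝ} (hC0 : 0 ≤ C) (hD : ∀ i, |D i| ≤ C)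
    (B : Finset (Fin (m + 1))) (hB : B ≠ univ) :
    ∫ b, sgn (b 0) * D (b 0).1 * ∏ k ∈ B, W.fac η k b ∂(W.chainLaw m) = 0 := by
  have hbd : ∀ b : BondCfg m, |sgn (b 0) * D (b 0).1 * ∏ k ∈ B, W.fac η k b| ≤ C := fun b => by
    rw [abs_mul, abs_mul, abs_sgn, one_mul]
    exact (mul_le_mul (hD _) (W.abs_prod_fac_le hη B b) (abs_nonneg _) hC0).trans (by rw [mul_one])
  by_cases h0 : (0 : Fin (m + 1)) ∈ B
  · obtain ⟨k, hk, h, hk1⟩ := exists_gap B h0 hB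
    refine W.integral_eq_zero_of_odd ⟨k.val + 1, h⟩ _ C hbd fun b => ?_
    have hne : (0 : Fin (m + 1)) ≠ ⟨k.val + 1, h⟩ := fun e => by
      have := congrArg Fin.val e; simp at this
    rw [prod_fac_flipAt, filter_reads_gap B hk h hk1, card_singleton, pow_one, sgn_flipAt, if_neg hne, flipAt_fst]
    ring
  · refine W.integral_eq_zero_of_odd 0 _ C hbd fun b => ?_
    rw [prod_fac_flipAt, filter_reads_zero B h0, card_empty, pow_zero, sgn_flipAt, if_pos rfl, flipAt_fst]
    ring

/-- «All consecutive mode indices agree» is «all mode indices equal the first». -/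
theorem allEq_iff (b : BondCfg m) :
    (∀ j : Fin m, (b j.castSucc).1 = (b j.succ).1) ↔ ∀ k : Fin (m + 1), (b k).1 = (b 0).1 := by
  constructor
  · intro h k
    induction k using Fin.induction with
    | zero => rfl
    | succ j ih => rw [← h j, ih]
  · intro h j; rw [h j.castSucc, h j.succ]

/-- The factor of an interior position, in `castSucc ∕ succ` form. -/
theorem fac_castSucc (η : ℕ → ℝ) (j : Fin m) (b : BondCfg m) :
    W.fac η j.castSucc b = W.Z * (if (b j.castSucc).1 = (b j.succ).1 then 1 else 0) * sgn (b j.castSucc) * sgn (b j.succ) := by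
  have h : (j.castSucc : Fin (m + 1)).val + 1 < m + 1 := by simp [j.isLt]
  have he : (⟨(j.castSucc : Fin (m + 1)).val + 1, h⟩ : Fin (m + 1)) = j.succ := Fin.ext (by simp)
  unfold fac
  rw [dif_pos h, he]

/-- The factor of the reading position. -/
theorem fac_last (η : ℕ → ℝ) (b : BondCfg m) :
    W.fac η (Fin.last m) b = 2 * W.Z * W.t (b (Fin.last m)).1 * η (b (Fin.last m)).1 * sgn (b (Fin.last m)) := by
  have h : ¬ ((Fin.last m).val + 1 < m + 1) := by simp
  unfold fac
  rw [dif_neg h]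

/-- **The full chain, pointwise**: decorated by the centre sign, the product of ALL factors is supported on «all labels show one mode `i`», where it
equals `2 Z^{m+1} t_i η_i D_i` (the signs square to `1`). -/
theorem sgn_mul_prod_fac (η D : ℕ → ℝ) (b : BondCfg m) :
    sgn (b 0) * D (b 0).1 * ∏ k, W.fac η k b =
      if ∀ k, (b k).1 = (b 0).1 then 2 * W.Z ^ (m + 1) * W.t (b 0).1 * η (b 0).1 * D (b 0).1 else 0 := by
  rw [Fin.prod_univ_castSucc]
  simp_rw [fac_castSucc, fac_last]
  rw [prod_mul_distrib, prod_mul_distrib, prod_mul_distrib, prod_const, card_univ, Fintype.card_fin, Fintype.prod_boole]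
  have hsq : (∏ j : Fin m, sgn (b j.castSucc)) * sgn (b (Fin.last m)) * (sgn (b 0) * ∏ j : Fin m, sgn (b j.succ)) = 1 := by
    rw [← Fin.prod_univ_castSucc (f := fun k => sgn (b k)), ← Fin.prod_univ_succ (f := fun k => sgn (b k)), ← prod_mul_distrib]
    exact prod_eq_one fun k _ => sgn_mul_self (b k)
  by_cases hall : ∀ k, (b k).1 = (b 0).1
  · have hall' : ∀ j : Fin m, (b j.castSucc).1 = (b j.succ).1 := (allEq_iff b).2 hall
    rw [if_pos hall, if_pos hall', hall (Fin.last m)]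
    calc sgn (b 0) * D (b 0).1 * (W.Z ^ m * 1 * (∏ j : Fin m, sgn (b j.castSucc)) * (∏ j : Fin m, sgn (b j.succ)) *
          (2 * W.Z * W.t (b 0).1 * η (b 0).1 * sgn (b (Fin.last m))))
        = 2 * W.Z ^ m * W.Z * W.t (b 0).1 * η (b 0).1 * D (b 0).1 *
          ((∏ j : Fin m, sgn (b j.castSucc)) * sgn (b (Fin.last m)) * (sgn (b 0) * ∏ j : Fin m, sgn (b j.succ))) := by ring
      _ = 2 * W.Z ^ (m + 1) * W.t (b 0).1 * η (b 0).1 * D (b 0).1 := by rw [hsq, pow_succ]; ring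
  · have hall' : ¬ ∀ j : Fin m, (b j.castSucc).1 = (b j.succ).1 := fun h => hall ((allEq_iff b).1 h)
    rw [if_neg hall, if_neg hall']
    ring

/-- **The full chain, integrated**: `∫ sgn₀ · D · ∏ fac = Σ_i 2 t_i^{m+2} η_i D_i`. -/
theorem integral_full_chain {η : ℕ → ℝ} (hη : ∀ i, |η i| ≤ 1) (D : ℕ → ℝ) {C : ℝ} (hC0 : 0 ≤ C) (hD : ∀ i, |D i| ≤ C) :
    ∫ b, sgn (b 0) * D (b 0).1 * ∏ k, W.fac η k b ∂(W.chainLaw m) = ∑' i, 2 * W.t i ^ (m + 2) * η i * D i := by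
  simp_rw [W.sgn_mul_prod_fac η D]
  have hK : ∀ i, |2 * W.Z ^ (m + 1) * W.t i * η i * D i| ≤ 2 * C := fun i => by
    rw [abs_mul, abs_mul, abs_mul, abs_mul, abs_two, abs_of_nonneg (pow_nonneg W.Z_pos.le _), abs_of_nonneg (W.t_nonneg i)]
    have h1 : W.Z ^ (m + 1) ≤ 1 := pow_le_one₀ W.Z_pos.le W.Z_le_one
    have h2 : W.t i ≤ 1 := (W.t_le_Z i).trans W.Z_le_one
    calc 2 * W.Z ^ (m + 1) * W.t i * |η i| * |D i| ≤ 2 * 1 * 1 * 1 * C := by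
          apply mul_le_mul _ (hD i) (abs_nonneg _) (by norm_num)
          apply mul_le_mul _ (hη i) (abs_nonneg _) (by norm_num)
          apply mul_le_mul _ h2 (W.t_nonneg i) (by norm_num)
          exact mul_le_mul_of_nonneg_left h1 (by norm_num)
      _ = 2 * C := by ring
  rw [W.integral_allEq (fun i => 2 * W.Z ^ (m + 1) * W.t i * η i * D i) (2 * C) (by linarith) hK]
  refine tsum_congr fun i => ?_
  have hZ : W.Z ^ (m + 1) ≠ 0 := pow_ne_zero _ W.Z_pos.ne'
  rw [div_pow]
  field_simp
  ring

/-! ### The normaliser is `1`, the numerator is the mode sum -/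

/-- **The normaliser is exactly `1`.** -/
theorem den_eq_one {η : ℕ → ℝ} (hη : ∀ i, |η i| ≤ 1) :
    ∫ b, ∏ k, (1 + W.fac η k b) ∂(W.chainLaw m) = 1 := by
  haveI := W.isProbabilityMeasure_chainLaw m
  simp_rw [prod_one_add]
  rw [integral_finsetSum _ fun B _ => ?_]
  · rw [sum_eq_single_of_mem ∅ (empty_mem_powerset _) fun B _ hB => W.integral_prod_fac_eq_zero hη B (nonempty_iff_ne_empty.2 hB)]
    simp
  · exact Integrable.of_bound (measurable_of_countable _).aestronglyMeasurable 1
      (Filter.Eventually.of_forall fun b => by rw [Real.norm_eq_abs]; exact W.abs_prod_fac_le hη B b)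

/-- **The numerator is the mode sum**: `∫ (A + ½ sgn₀ D) ∏ (1 + fac) = A + Σ_i t_i^{m+2} η_i D_i`. -/
theorem num_eq {η : ℕ → ℝ} (hη : ∀ i, |η i| ≤ 1) (A : ℝ) (D : ℕ → ℝ) {C : ℝ} (hC0 : 0 ≤ C) (hD : ∀ i, |D i| ≤ C) :
    ∫ b, obsR A D b * ∏ k, (1 + W.fac η k b) ∂(W.chainLaw m) = A + ∑' i, W.t i ^ (m + 2) * η i * D i := by
  haveI := W.isProbabilityMeasure_chainLaw m
  have hint1 : ∀ B : Finset (Fin (m + 1)), Integrable (fun b => ∏ k ∈ B, W.fac η k b) (W.chainLaw m) := fun B =>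
    Integrable.of_bound (measurable_of_countable _).aestronglyMeasurable 1
      (Filter.Eventually.of_forall fun b => by rw [Real.norm_eq_abs]; exact W.abs_prod_fac_le hη B b)
  have hint2 : ∀ B : Finset (Fin (m + 1)), Integrable (fun b => sgn (b 0) * D (b 0).1 * ∏ k ∈ B, W.fac η k b) (W.chainLaw m) :=
    fun B => Integrable.of_bound (measurable_of_countable _).aestronglyMeasurable C
      (Filter.Eventually.of_forall fun b => by
        rw [Real.norm_eq_abs, abs_mul, abs_mul, abs_sgn, one_mul]
        exact (mul_le_mul (hD _) (W.abs_prod_fac_le hη B b) (abs_nonneg _) hC0).trans (by rw [mul_one]))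
  have hsplit : ∀ b : BondCfg m, obsR A D b * ∏ k, (1 + W.fac η k b) =
      ∑ B ∈ (univ : Finset (Fin (m + 1))).powerset,
        (A * ∏ k ∈ B, W.fac η k b + 1 / 2 * (sgn (b 0) * D (b 0).1 * ∏ k ∈ B, W.fac η k b)) := fun b => by
    rw [prod_one_add, mul_sum]
    refine sum_congr rfl fun B _ => ?_
    unfold obsR; ring
  have hint3 : ∀ B : Finset (Fin (m + 1)), Integrable (fun b => A * ∏ k ∈ B, W.fac η k b +
      1 / 2 * (sgn (b 0) * D (b 0).1 * ∏ k ∈ B, W.fac η k b)) (W.chainLaw m) := fun B =>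
    ((hint1 B).const_mul A).add ((hint2 B).const_mul (1 / 2))
  simp_rw [hsplit]
  rw [integral_finsetSum _ fun B _ => hint3 B]
  rw [sum_congr rfl fun B _ => integral_add ((hint1 B).const_mul A) ((hint2 B).const_mul (1 / 2))]
  simp_rw [integral_const_mul]
  rw [sum_add_distrib, ← mul_sum, ← mul_sum,
    sum_eq_single_of_mem ∅ (empty_mem_powerset _) (fun B _ hB => W.integral_prod_fac_eq_zero hη B (nonempty_iff_ne_empty.2 hB)),
    sum_eq_single_of_mem (univ : Finset (Fin (m + 1))) (mem_powerset_self _)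
      (fun B _ hB => W.integral_sgn_prod_fac_eq_zero hη D hC0 hD B hB)]
  simp only [prod_empty, integral_const, probReal_univ, smul_eq_mul, mul_one]
  rw [W.integral_full_chain hη D hC0 hD, ← tsum_mul_left]
  congr 1
  exact tsum_congr fun i => by ring

end Weights

end Chain

end Summit.QuantumFields.YangMills.Cruxes.IR.BlockedActivity

end
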